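import Summits.QuantumFields.YangMills.Theorems.BalabanUVNodesN07KLNOfLocalityRows
import Summits.QuantumFields.YangMills.Theorems.BalabanUVNodesN07FramedLettersOfThm312313
import HarnessLib

/-!
# THE №621 JUNCTION PINS, ROWS EDITION — the SL pin `hierFrameDatumOfRecord` and the GL pin `hierFrameGLDatumOfRecord` of ✓`…KLCPrAtHierFrameParam` §2∕§3 with (i) the (KL-N)ᵖʳ
# group DISCHARGED from {W2} ∧ {W3} (▶ PT-A g12's ✓`…N07KLNOfLocalityRows` §4, INSTANTIATED), and (ii) ALL THREE propagator letter groups (ℓa-H)ᵖʳ ∕ (KL-H)ᵖʳ ∕ (KL-N)ᵖʳ DISCHARGED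
# from ONE displayed (3.133) pair of `H₁^{pr}(U₀)` and the locality rows of `Δπ(U₀; G′, Q′)`

Cell `pub-ymgap` ∕ `ym-nodeO-ideate`, porter lineage `ymgap-nodeO-port-PTB-1` (gen 12); ★★★ director-ym g24 №655 next-on-arrival (i) («the GL∕SL-pin INSTANCES of PT-A g12's generic (B)
file at the re-pinned pins ✓p831721 — your K0ᴬ home turf — once (B) lands»).  `--kind proof --supports stmt-QuantumFields-27238 --as helper`; count-neutral; NEW basename; the pins file
✓`…KLCPrAtHierFrameParam` and ▶ PT-A's ✓`…N07KLNOfLocalityRows` are NOT edited.  [B7] = [Balaban1985Averaging]; [B9] = [Balaban1985BackgroundPropagators]; [B11] = [15] =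
[Balaban1985Variational]; [4] = [Balaban1984PropagatorsII].

THE PRINT.  [B11] p. 291 (87)–(88): *«⟨A′, Δ_π HD(A′)⟩ = ⟨A′, (Δ_U + DRD*)HD(A′)⟩ … Applying the inequalities (3.132) from [5], (55), (73) … we can estimate this functional derivative by
O(1)ε₁(Lʲη)⁻³ on Ω_j»*; [B9] Thm 3.12 (3.133) p. 422 (the entry rows of `H₁`); [4] (2.61) p. 234 (row sum).  ★ PT-B g11's K0ᴬ letter triage (nodeO STATUS 19:48Z) named the walls:
{W2} = the (3.133) rows of `H₁^{pr}(U₀)` (lane N07, XL), {W3} = the current-insertion locality of `Δπ` ([B11] (72)–(73)∕(86)–(89), L), {W4} = [B7] Prop. 5 (157) (hand-KLC), {W1} admissibility.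

WHAT IS PROVED (0 def, 0 sorry, axioms standard; ns `Summit.QuantumFields.YangMills.Theorems.KExpOfRecordPr`; node-00 `∀ x, x ∈ Ω_k`, `0 < k ≤ m + K`):
* §1 `prop4UniformPrAtRecord_node00_of_prop5Clause_hierFrameRec_of_localityRows` — THE SL PIN with the six (KL-N)ᵖʳ binders `hk′0 ∕ hNk ∕ hΘ′0 ∕ hΘ′ ∕ hN₁0 ∕ hN₁` OBTAINED from
  ✓`klNPr_of_localityRows_of_entryBounds` ({W2} `h0 ∕ h1` at `(B₀, ρ)`, {W3} `hS` (L) ∕ `hR` (R) at `(s₀, s₁; C_π, σ)`); `N₁ := C_π B₀ d(2(1+1∕m))^d · d(2(1+1∕m))^d`, `Θ′ := (L^d)^k · N₁`,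
  `m := min σ ρ ∕ 2`; every other letter verbatim (▶ PT-A g12's kernel witness, SL twin).
  ★★★ `prop4UniformPrAtRecord_node00_of_prop5Clause_hierFrameRec_of_entryRows` — THE SL PIN with (ℓa-H)ᵖʳ `hH` (✓`prop4LetterHPrAtRecord_of_entryBounds`, `b := B₀ · d(2(1+1∕ρ))^d`),
  (KL-H)ᵖʳ (✓`klH_of_entryBounds`, `hk := ‖colOp H₁^{pr} y b′‖`, `Θ_H = Θ_H^w := (L^d)^k · b`) AND (KL-N)ᵖʳ (as above) ALL DISCHARGED from the ONE pair `h0 ∕ h1` and {W3}: the pin's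
  REMAINING displayed letters are exactly `hpos`∕`hQ`, {W2} `h0 ∕ h1`, {W3} `hS ∕ hR`, the (157) clause `h157` of `B7.Prop5Printed (kexpOfRecordPr F N 𝔥_rec)` with `r + r ≤ α₁` and the
  window `hq` (at `Θ_H = (L^d)^k · b`), `‖J‖ ≤ nJ`, print's (14) `hreg`, `∀ x, x ∈ Ω_k` — FOUR content letters ({W1} `hpos`∕`hQ`, {W2}, {W3}, {W4}) + format.
* §2 `prop4UniformPrAtRecord_node00_of_prop5Clause_hierFrameGLRec_of_localityRows`, ★★★ `…_hierFrameGLRec_of_entryRows` — the same two at the GL pin (▶ PT-A g12's kernel witness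
  `g11/KLNPrWitness.SCRATCH` is the first, filed here under the lineage that owns the pins; `hQ` there ⟸ ✓`QprOfRecord_surjective_hierFrameGL_of_qCplxOp`).
The family door (datum `𝔥` a binder, window constant `c𝔥` a binder) gets the same two editions in the sibling file `…KLCPrFamilyRows`.
DecidableEq: the pins' `[DecidableEq (PBond (F.P K) k)]` binder is RESOLVED at the call site (tree's global instance), not re-bound — ▶ PT-A's located lesson (n07-e ↔ G4).

HONEST FRAMING.  Glue BY NAME over landed theorems (two `obtain`s and one `exact` per theorem); {W2} and {W3} are DISPLAYED per-member hypotheses INHABITED NOWHERE — nothing of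
[B9] Thm 3.12 ∕ (3.132)–(3.133), of [B11] (72)–(73)∕(86)–(89) (the decay of `R`, the locality of `Δ_π`), of [B11] Prop. 4 or of [B7] Prop. 5 is proved here; `Θ_H`, `Θ′` are NOT
k-free (G1 pairs them with (KL-C)'s `G ~ η^d`); k-uniformity of `C_π, σ, B₀, ρ` is the suppliers' problem; `B7.Prop5Printed (kexpOfRecordPr F N 𝔥_rec)` neither proved nor refuted;
K0ᴬ ⟨stmt-QuantumFields-27238⟩ NOT closed (0∕2); ⟨27931⟩ CLOSED·IMPLICATION-ONLY; ⟨27930⟩ 2∕7 (v3.8); NODE O 0∕1; COUNT 8∕28 · K 1∕4 UNMOVED; one finite `𝕋⁴_{L^K}` programme at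
fixed ε — NOT continuum ∕ ℝ⁴ ∕ OS ∕ Clay; **the Yang–Mills mass gap (Clay) is NOT proved by any of this.**  No `sorry`, `instance`, `notation`, `set_option`; standard axioms.
-/

noncomputable section

open scoped Matrix Matrix.Norms.L2Operator InnerProductSpace ComplexConjugate BigOperators
open Classical

namespace Summit.QuantumFields.YangMills.Theorems.KExpOfRecordPr

open Literature.MathematicalPhysics.QuantumFieldTheory.Balaban1983to89
open Literature.MathematicalPhysics.QuantumFieldTheory.Balaban1983to89.Node00
open Summit.QuantumFields.YangMills.Theorems.KExpOfRecord (KRecIdx kexpOfRecord)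
open T4Continuum BlockAveraging
open B10Eq42TorusConstraint (bondsIn)
open B10Eq38TorusDomains (toFine)
open B11Eq103H1Complex (SiteL2K)
open B9SectCLatticeCarrier (Bond)
open B11Eq115Space (NegSup NegSize JetSup levWeight levWeight_apply)
open B11Eq90Transpose (single115)
open B11Eq90V0primeCurrent (flat115)
open B11Eq111FrakG (nabla115)
open B15AveragingHolomorphic (iterMh)
open Summit.QuantumFields.YangMills.BalabanUVNodes.N07Prop4LetterHOfThm312 (blkOfBond)
open Summit.QuantumFields.YangMills.BalabanUVNodes.N07KernelEntriesOfRecord (entry0 entry1 nColOp klH_of_entryBounds)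
open Summit.QuantumFields.YangMills.BalabanUVNodes.N07FramedLettersOfThm312313 (prop4LetterHPrAtRecord_of_entryBounds)
open Summit.QuantumFields.YangMills.BalabanUVNodes.N07KLNOfLocalityRows (klNPr_of_localityRows_of_entryBounds blockRow0 blockRow1)

variable (F : T4Family) (N : ℕ) [NeZero N]

/-! ## §1  The SL pin `hierFrameDatumOfRecord` (no frame debt): (KL-N)ᵖʳ ⇐ {W2} ∧ {W3}; then ALL THREE letter groups ⇐ ONE (3.133) pair ∧ {W3} -/

section Prop4

variable (K k : ℕ) (Ω : ℕ → Set (Site (F.P K) 0)) (U₀ : GaugeField (F.P K) 0 (SU N))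
variable [Fact (0 < (F.L : ℝ))] [Fact (0 < (F.P K).eta k)] [Fact (0 < c0Rec F K k)] [Fact (∀ c, 0 < wBRec F K k c)]

/-- ★★ **THE SL PIN ✓`prop4UniformPrAtRecord_node00_of_prop5Clause_hierFrameRec` WITH THE (KL-N)ᵖʳ GROUP DISCHARGED FROM {W2} ∧ {W3}** (`𝔥 := hierFrameDatumOfRecord`,
`C₂ = 2.816·10¹⁷·L·N`, `c₄ = (2·10¹¹·L·N)⁻¹`, no frame debt): ▶ PT-A's ✓`klNPr_of_localityRows_of_entryBounds` feeds `hk′0 ∕ hNk ∕ hΘ′0 ∕ hΘ′ ∕ hN₁0 ∕ hN₁` BY NAME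
(`N₁ := C_π B₀ d(2(1+1∕m))^d · d(2(1+1∕m))^d`, `Θ′ := (L^d)^k · N₁`); every other displayed letter verbatim.  Glue; nothing of [B7]∕[B9]∕[B11] proved.
[cite: Balaban1985Variational, Prop. 4 (97)–(98) pp.292–293, (72)–(73) p.289, (86)–(89) p.291, (130) p.298; Balaban1985Averaging, Proposition 5 (157) p.42; Balaban1985BackgroundPropagators, Thm 3.12 (3.132)–(3.133) p.422; Balaban1984PropagatorsII, (2.61) p.234] -/
theorem prop4UniformPrAtRecord_node00_of_prop5Clause_hierFrameRec_of_localityRows (levB : PBond (F.P K) k → ℕ) (a : ℝ)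
    (hpos : ∀ x, x ≠ 0 → 0 < RCLike.re ⟪x, laplaceAOfRecord F N k U₀ (QprOfRecord F N k U₀ (hierFrameDatumOfRecord F N k U₀)) (QprimeOfRecord F N k U₀) a x⟫_ℂ)
    (hQ : Function.Surjective (QprOfRecord F N k U₀ (hierFrameDatumOfRecord F N k U₀)))
    (Gp : SiteL2K ℂ (F.P K).d (fun _ => (F.P K).sitesPerDir 0) (c0Rec F K k) (WRec N) →ₗ[ℂ]
      SiteL2K ℂ (F.P K).d (fun _ => (F.P K).sitesPerDir 0) (c0Rec F K k) (WRec N))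
    {b α nJ : ℝ} (hkpos : 0 < k) (hkm : k ≤ (F.P K).m + (F.P K).K) (hb : 0 ≤ b) (hΩ : ∀ x, x ∈ Ω k) (hαpos : 0 < α) (hα : α * (11000000 * N) ≤ 1)
    (hreg : ∀ j, j < k → PlaqSmall (α * ((F.L : ℝ) ^ j * (F.P K).eta k) ^ 2) (Averaging.iter (avOfRecord F N K) j U₀))
    (hH : Prop4LetterHPrAtRecord F N K k Ω U₀ (hierFrameDatumOfRecord F N k U₀) levB a hpos hQ b)
    -- (KL-H)ᵖʳ
    {hk : Bond (F.P K).d (fun _ => (F.P K).sitesPerDir 0) → PBond (F.P K) k → ℝ} (hk0 : ∀ b' y, 0 ≤ hk b' y)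
    (hHk : ∀ (y : PBond (F.P K) k) (Z : Matrix (Fin N) (Fin N) ℂ) (b' : Bond (F.P K).d (fun _ => (F.P K).sitesPerDir 0)),
      ‖flat115 (H1prOfRecordAtBg F N K k Ω U₀ (hierFrameDatumOfRecord F N k U₀) levB a hpos hQ
          ((NegSup.equiv (levWeight (F.L : ℝ) ((F.P K).eta k) levB 0) (Matrix (Fin N) (Fin N) ℂ)).symm (Pi.single y Z))) b'‖ ≤ hk b' y * ‖Z‖)
    {ΘH : ℝ} (hΘH : 0 ≤ ΘH) (hH1 : ∀ y, ∑ b', hk b' y ≤ ΘH) {ΘHw : ℝ} (hΘHw : 0 ≤ ΘHw)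
    (hHw : ∀ (bb : Bond (F.P K).d (fun _ => (F.P K).sitesPerDir 0)) (y : PBond (F.P K) k),
      ∑ b', levWeight (F.L : ℝ) ((F.P K).eta k) (bondLevLit F Ω k) 3 bb / levWeight (F.L : ℝ) ((F.P K).eta k) (bondLevLit F Ω k) 3 b' * hk b' y ≤ ΘHw)
    -- (KL-C)ᵖʳ := the (157) clause of `B7.Prop5Printed (kexpOfRecordPr F N 𝔥_rec)` at `(α, α₁, C₃)`, `r + r ≤ α₁`, and the window
    {C₃ α₁ : ℝ} (hC₃ : 0 ≤ C₃)
    (h157 : ∀ (i : KRecIdx F) (U₀ : (kexpOfRecordPr F N (fun K k (U₀ : GaugeField (F.P K) 0 (SU N)) => hierFrameDatumOfRecord F N k U₀) i).Cfg), (kexpOfRecordPr F N (fun K k (U₀ : GaugeField (F.P K) 0 (SU N)) => hierFrameDatumOfRecord F N k U₀) i).plaqDevEta U₀ < α →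
      ∀ A : (kexpOfRecordPr F N (fun K k (U₀ : GaugeField (F.P K) 0 (SU N)) => hierFrameDatumOfRecord F N k U₀) i).Fld, (kexpOfRecordPr F N (fun K k (U₀ : GaugeField (F.P K) 0 (SU N)) => hierFrameDatumOfRecord F N k U₀) i).fldNorm A < α₁ → (kexpOfRecordPr F N (fun K k (U₀ : GaugeField (F.P K) 0 (SU N)) => hierFrameDatumOfRecord F N k U₀) i).dCk U₀ A ≤ C₃ * (kexpOfRecordPr F N (fun K k (U₀ : GaugeField (F.P K) 0 (SU N)) => hierFrameDatumOfRecord F N k U₀) i).fldNorm A)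
    (hrα₁ : letI C₂ : ℝ := 281600000000000000 * (F.L : ℝ) * N
      letI c₄ : ℝ := 1 / (200000000000 * (F.L : ℝ) * N)
      letI r : ℝ := min (c₄ / 4) (min (1 / 2) (1 / (16 * (b * C₂ + 1))))
      r + r ≤ α₁)
    (hq : letI C₂ : ℝ := 281600000000000000 * (F.L : ℝ) * N
      letI c₄ : ℝ := 1 / (200000000000 * (F.L : ℝ) * N)
      letI r : ℝ := min (c₄ / 4) (min (1 / 2) (1 / (16 * (b * C₂ + 1))))
      (r + r) * ΘH * (2 * ((F.P K).d : ℝ) * (C₃ * (F.P K).eta k ^ (F.P K).d)) ≤ 1 / 2)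
    -- {W3} := the locality rows of the current reader `Δπ(U₀; G′, Q′)` ([B11] (72)–(73)∕(86)–(89)): (L) fine majorants `s₀, s₁`, (R) block-aggregated row decay — DISPLAYED
    {s0 : Bond (F.P K).d (fun _ => (F.P K).sitesPerDir 0) → Bond (F.P K).d (fun _ => (F.P K).sitesPerDir 0) → ℝ} {s1 : Bond (F.P K).d (fun _ => (F.P K).sitesPerDir 0) → Bond (F.P K).d (fun _ => (F.P K).sitesPerDir 0) × Fin (F.P K).d → ℝ} (hs0 : ∀ b' x, 0 ≤ s0 b' x) (hs1 : ∀ b' p, 0 ≤ s1 b' p)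
    (hS : ∀ (A : Space115Lit F N K k Ω U₀) (b' : Bond (F.P K).d (fun _ => (F.P K).sitesPerDir 0)),
      ‖NegSup.equiv (levWeight (F.L : ℝ) ((F.P K).eta k) (bondLevLit F Ω k) 3) (Matrix (Fin N) (Fin N) ℂ) (DeltaPiCurOfRecord F N K k Ω U₀ Gp (QprimeOfRecord F N k U₀) A) b'‖ ≤
        ∑ x : Bond (F.P K).d (fun _ => (F.P K).sitesPerDir 0), s0 b' x * ‖JetSup.equiv _ _ _ A x‖ +
        ∑ p : Bond (F.P K).d (fun _ => (F.P K).sitesPerDir 0) × Fin (F.P K).d, s1 b' p * ‖(nabla115 ((F.P K).eta k) (unitsOfRecord F N U₀)) (JetSup.equiv _ _ _ A) p‖)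
    {Cπ σ : ℝ} (hCπ : 0 ≤ Cπ) (hσ : 0 < σ)
    (hR : ∀ (b' : Bond (F.P K).d (fun _ => (F.P K).sitesPerDir 0)) (y'' : PBond (F.P K) k),
      blockRow0 F K k s0 b' y'' + blockRow1 F K k s1 b' y'' ≤
        Cπ * Real.exp (-(σ * (Site.tdist (blkOfBond F K k b').src y''.src : ℝ))))
    -- {W2} := the (3.133) entry rows of `H₁^{pr}(U₀)` at `(B₀, ρ)` ([B9] Thm 3.12; lane N07) — DISPLAYED
    {B₀ ρ : ℝ} (hB₀ : 0 ≤ B₀) (hρ : 0 < ρ)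
    (h0 : ∀ y'' y : PBond (F.P K) k, entry0 F N K k Ω U₀ levB (H1prOfRecordAtBg F N K k Ω U₀ (hierFrameDatumOfRecord F N k U₀) levB a hpos hQ) y'' y ≤ B₀ * Real.exp (-(ρ * (Site.tdist y''.src y.src : ℝ))))
    (h1 : ∀ y'' y : PBond (F.P K) k, entry1 F N K k Ω U₀ levB (H1prOfRecordAtBg F N K k Ω U₀ (hierFrameDatumOfRecord F N k U₀) levB a hpos hQ) y'' y ≤ B₀ * Real.exp (-(ρ * (Site.tdist y''.src y.src : ℝ))))
    (hJ : ‖JOfRecordAtBg F N K k Ω U₀‖ ≤ nJ) :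
    letI N₁ : ℝ := Cπ * B₀ * ((F.P K).d * (2 * (1 + 1 / (min σ ρ / 2))) ^ (F.P K).d) * ((F.P K).d * (2 * (1 + 1 / (min σ ρ / 2))) ^ (F.P K).d)
    letI Θ' : ℝ := ((((F.P K).L ^ (F.P K).d) ^ k : ℕ) : ℝ) * N₁
    letI C₂ : ℝ := 281600000000000000 * (F.L : ℝ) * N
    letI c₄ : ℝ := 1 / (200000000000 * (F.L : ℝ) * N)
    letI r : ℝ := min (c₄ / 4) (min (1 / 2) (1 / (16 * (b * C₂ + 1))))
    letI R' : ℝ := min r ((1 - 4 * b * C₂ * (r + r)) * (1 / 16))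
    letI CV : ℝ := 1024 * (((F.P K).d - 1 : ℕ) : ℝ) * ((1 : ℝ) * 1) ^ 3 * N * (α * (1 : ℝ) ^ 2 + 1 / 16)
        + (((F.P K).d - 1 : ℕ) : ℝ) * ((1 : ℝ) * 1) ^ 3 * (136 + 2 * ((1 : ℝ) * 1)) * N
    letI G : ℝ := 2 * ((F.P K).d : ℝ) * (C₃ * (F.P K).eta k ^ (F.P K).d)
    letI θ₃ : ℝ := (2 * (1 / (1 - 4 * b * C₂ * (r + r))) + 1) * ΘHw * G / r
    letI θE : ℝ := 2 * ΘHw * G * (1 / (1 - 4 * b * C₂ * (r + r)))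
    letI θE' : ℝ := 2 * Θ' * G * (1 / (1 - 4 * b * C₂ * (r + r)))
    Prop4UniformPrAtRecord F N K k Ω U₀ (hierFrameDatumOfRecord F N k U₀) levB a hpos hQ r Gp
      ((N * θ₃ * nJ + (N₁ * C₂ * (1 / (1 - 4 * b * C₂ * (r + r))) ^ 2 + N * θE')
        + N * θE * (N₁ * C₂ * (1 / (1 - 4 * b * C₂ * (r + r))) ^ 2) * R'
        + N * (1 + θE * R') * CV * (1 / (1 - 4 * b * C₂ * (r + r))) ^ 2)) R' := by
  obtain ⟨hk'0, hNk, hΘ'0, hΘ', hN₁0, hN₁⟩ := klNPr_of_localityRows_of_entryBounds F N K k Ω U₀ levB (hierFrameDatumOfRecord F N k U₀) a hpos hQ Gp hΩ hkm hs0 hs1 hS hCπ hσ hR hB₀ hρ h0 h1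
  exact prop4UniformPrAtRecord_node00_of_prop5Clause_hierFrameRec F N K k Ω U₀ levB a hpos hQ Gp hkpos hkm hb hΩ hαpos hα hreg hH hk0 hHk hΘH hH1 hΘHw hHw hC₃ h157 hrα₁ hq
    hk'0 hNk hΘ'0 hΘ' hN₁0 hN₁ hJ

/-- ★★★ **THE SL PIN WITH ALL THREE PROPAGATOR LETTER GROUPS DISCHARGED FROM ONE DISPLAYED (3.133) PAIR AND THE LOCALITY ROWS OF `Δπ`** (`𝔥 := hierFrameDatumOfRecord`, no frame
debt, `C₂ = 2.816·10¹⁷·L·N`): (ℓa-H)ᵖʳ by ✓`prop4LetterHPrAtRecord_of_entryBounds` (`b := B₀ · d(2(1+1∕ρ))^d`), (KL-H)ᵖʳ by ✓`klH_of_entryBounds` (`Θ_H = Θ_H^w := (L^d)^k · b`), (KL-N)ᵖʳ by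
▶ PT-A's ✓`klNPr_of_localityRows_of_entryBounds`.  REMAINING displayed letters: `hpos`∕`hQ` at `QprOfRecord … (hierFrameDatumOfRecord …)`, {W2} `h0 ∕ h1`, {W3} `hS ∕ hR`, the (157) clause
`h157` of `B7.Prop5Printed (kexpOfRecordPr F N 𝔥_rec)` with `r + r ≤ α₁` and the window `hq`, `‖J‖ ≤ nJ`, print's (14) `hreg`, `∀ x, x ∈ Ω_k`.  Glue BY NAME; {W2}∕{W3} INHABITED NOWHERE;
nothing of [B7]∕[B9]∕[B11] proved.
[cite: Balaban1985Variational, Prop. 4 (97)–(98) pp.292–293, (45)–(46) p.285, (72)–(73) p.289, (86)–(89) p.291, (103) p.293, (130) p.298; Balaban1985Averaging, Proposition 5 (157) p.42; Balaban1985BackgroundPropagators, Thm 3.12 (3.126) p.420, (3.132)–(3.133) p.422; Balaban1984PropagatorsII, Lemma 2.1 (2.61) p.234] -/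
theorem prop4UniformPrAtRecord_node00_of_prop5Clause_hierFrameRec_of_entryRows (levB : PBond (F.P K) k → ℕ) (a : ℝ)
    (hpos : ∀ x, x ≠ 0 → 0 < RCLike.re ⟪x, laplaceAOfRecord F N k U₀ (QprOfRecord F N k U₀ (hierFrameDatumOfRecord F N k U₀)) (QprimeOfRecord F N k U₀) a x⟫_ℂ)
    (hQ : Function.Surjective (QprOfRecord F N k U₀ (hierFrameDatumOfRecord F N k U₀)))
    (Gp : SiteL2K ℂ (F.P K).d (fun _ => (F.P K).sitesPerDir 0) (c0Rec F K k) (WRec N) →ₗ[ℂ]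
      SiteL2K ℂ (F.P K).d (fun _ => (F.P K).sitesPerDir 0) (c0Rec F K k) (WRec N))
    {α nJ : ℝ} (hkpos : 0 < k) (hkm : k ≤ (F.P K).m + (F.P K).K) (hΩ : ∀ x, x ∈ Ω k) (hαpos : 0 < α) (hα : α * (11000000 * N) ≤ 1)
    (hreg : ∀ j, j < k → PlaqSmall (α * ((F.L : ℝ) ^ j * (F.P K).eta k) ^ 2) (Averaging.iter (avOfRecord F N K) j U₀))
    -- {W2} := the (3.133) entry rows of `H₁^{pr}(U₀)` at `(B₀, ρ)` ([B9] Thm 3.12; lane N07) — DISPLAYED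
    {B₀ ρ : ℝ} (hB₀ : 0 ≤ B₀) (hρ : 0 < ρ)
    (h0 : ∀ y'' y : PBond (F.P K) k, entry0 F N K k Ω U₀ levB (H1prOfRecordAtBg F N K k Ω U₀ (hierFrameDatumOfRecord F N k U₀) levB a hpos hQ) y'' y ≤ B₀ * Real.exp (-(ρ * (Site.tdist y''.src y.src : ℝ))))
    (h1 : ∀ y'' y : PBond (F.P K) k, entry1 F N K k Ω U₀ levB (H1prOfRecordAtBg F N K k Ω U₀ (hierFrameDatumOfRecord F N k U₀) levB a hpos hQ) y'' y ≤ B₀ * Real.exp (-(ρ * (Site.tdist y''.src y.src : ℝ))))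
    -- (KL-C)ᵖʳ := the (157) clause of `B7.Prop5Printed (kexpOfRecordPr F N 𝔥_rec)` at `(α, α₁, C₃)`, `r + r ≤ α₁`, and the window
    {C₃ α₁ : ℝ} (hC₃ : 0 ≤ C₃)
    (h157 : ∀ (i : KRecIdx F) (U₀ : (kexpOfRecordPr F N (fun K k (U₀ : GaugeField (F.P K) 0 (SU N)) => hierFrameDatumOfRecord F N k U₀) i).Cfg), (kexpOfRecordPr F N (fun K k (U₀ : GaugeField (F.P K) 0 (SU N)) => hierFrameDatumOfRecord F N k U₀) i).plaqDevEta U₀ < α →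
      ∀ A : (kexpOfRecordPr F N (fun K k (U₀ : GaugeField (F.P K) 0 (SU N)) => hierFrameDatumOfRecord F N k U₀) i).Fld, (kexpOfRecordPr F N (fun K k (U₀ : GaugeField (F.P K) 0 (SU N)) => hierFrameDatumOfRecord F N k U₀) i).fldNorm A < α₁ → (kexpOfRecordPr F N (fun K k (U₀ : GaugeField (F.P K) 0 (SU N)) => hierFrameDatumOfRecord F N k U₀) i).dCk U₀ A ≤ C₃ * (kexpOfRecordPr F N (fun K k (U₀ : GaugeField (F.P K) 0 (SU N)) => hierFrameDatumOfRecord F N k U₀) i).fldNorm A)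
    (hrα₁ : letI b : ℝ := B₀ * ((F.P K).d * (2 * (1 + 1 / ρ)) ^ (F.P K).d)
      letI C₂ : ℝ := 281600000000000000 * (F.L : ℝ) * N
      letI c₄ : ℝ := 1 / (200000000000 * (F.L : ℝ) * N)
      letI r : ℝ := min (c₄ / 4) (min (1 / 2) (1 / (16 * (b * C₂ + 1))))
      r + r ≤ α₁)
    (hq : letI b : ℝ := B₀ * ((F.P K).d * (2 * (1 + 1 / ρ)) ^ (F.P K).d)
      letI ΘH : ℝ := ((((F.P K).L ^ (F.P K).d) ^ k : ℕ) : ℝ) * b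
      letI C₂ : ℝ := 281600000000000000 * (F.L : ℝ) * N
      letI c₄ : ℝ := 1 / (200000000000 * (F.L : ℝ) * N)
      letI r : ℝ := min (c₄ / 4) (min (1 / 2) (1 / (16 * (b * C₂ + 1))))
      (r + r) * ΘH * (2 * ((F.P K).d : ℝ) * (C₃ * (F.P K).eta k ^ (F.P K).d)) ≤ 1 / 2)
    -- {W3} := the locality rows of the current reader `Δπ(U₀; G′, Q′)` ([B11] (72)–(73)∕(86)–(89)): (L) fine majorants `s₀, s₁`, (R) block-aggregated row decay — DISPLAYED
    {s0 : Bond (F.P K).d (fun _ => (F.P K).sitesPerDir 0) → Bond (F.P K).d (fun _ => (F.P K).sitesPerDir 0) → ℝ} {s1 : Bond (F.P K).d (fun _ => (F.P K).sitesPerDir 0) → Bond (F.P K).d (fun _ => (F.P K).sitesPerDir 0) × Fin (F.P K).d → ℝ} (hs0 : ∀ b' x, 0 ≤ s0 b' x) (hs1 : ∀ b' p, 0 ≤ s1 b' p)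
    (hS : ∀ (A : Space115Lit F N K k Ω U₀) (b' : Bond (F.P K).d (fun _ => (F.P K).sitesPerDir 0)),
      ‖NegSup.equiv (levWeight (F.L : ℝ) ((F.P K).eta k) (bondLevLit F Ω k) 3) (Matrix (Fin N) (Fin N) ℂ) (DeltaPiCurOfRecord F N K k Ω U₀ Gp (QprimeOfRecord F N k U₀) A) b'‖ ≤
        ∑ x : Bond (F.P K).d (fun _ => (F.P K).sitesPerDir 0), s0 b' x * ‖JetSup.equiv _ _ _ A x‖ +
        ∑ p : Bond (F.P K).d (fun _ => (F.P K).sitesPerDir 0) × Fin (F.P K).d, s1 b' p * ‖(nabla115 ((F.P K).eta k) (unitsOfRecord F N U₀)) (JetSup.equiv _ _ _ A) p‖)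
    {Cπ σ : ℝ} (hCπ : 0 ≤ Cπ) (hσ : 0 < σ)
    (hR : ∀ (b' : Bond (F.P K).d (fun _ => (F.P K).sitesPerDir 0)) (y'' : PBond (F.P K) k),
      blockRow0 F K k s0 b' y'' + blockRow1 F K k s1 b' y'' ≤
        Cπ * Real.exp (-(σ * (Site.tdist (blkOfBond F K k b').src y''.src : ℝ))))
    (hJ : ‖JOfRecordAtBg F N K k Ω U₀‖ ≤ nJ) :
    letI b : ℝ := B₀ * ((F.P K).d * (2 * (1 + 1 / ρ)) ^ (F.P K).d)
    letI ΘHw : ℝ := ((((F.P K).L ^ (F.P K).d) ^ k : ℕ) : ℝ) * b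
    letI N₁ : ℝ := Cπ * B₀ * ((F.P K).d * (2 * (1 + 1 / (min σ ρ / 2))) ^ (F.P K).d) * ((F.P K).d * (2 * (1 + 1 / (min σ ρ / 2))) ^ (F.P K).d)
    letI Θ' : ℝ := ((((F.P K).L ^ (F.P K).d) ^ k : ℕ) : ℝ) * N₁
    letI C₂ : ℝ := 281600000000000000 * (F.L : ℝ) * N
    letI c₄ : ℝ := 1 / (200000000000 * (F.L : ℝ) * N)
    letI r : ℝ := min (c₄ / 4) (min (1 / 2) (1 / (16 * (b * C₂ + 1))))
    letI R' : ℝ := min r ((1 - 4 * b * C₂ * (r + r)) * (1 / 16))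
    letI CV : ℝ := 1024 * (((F.P K).d - 1 : ℕ) : ℝ) * ((1 : ℝ) * 1) ^ 3 * N * (α * (1 : ℝ) ^ 2 + 1 / 16)
        + (((F.P K).d - 1 : ℕ) : ℝ) * ((1 : ℝ) * 1) ^ 3 * (136 + 2 * ((1 : ℝ) * 1)) * N
    letI G : ℝ := 2 * ((F.P K).d : ℝ) * (C₃ * (F.P K).eta k ^ (F.P K).d)
    letI θ₃ : ℝ := (2 * (1 / (1 - 4 * b * C₂ * (r + r))) + 1) * ΘHw * G / r
    letI θE : ℝ := 2 * ΘHw * G * (1 / (1 - 4 * b * C₂ * (r + r)))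
    letI θE' : ℝ := 2 * Θ' * G * (1 / (1 - 4 * b * C₂ * (r + r)))
    Prop4UniformPrAtRecord F N K k Ω U₀ (hierFrameDatumOfRecord F N k U₀) levB a hpos hQ r Gp
      ((N * θ₃ * nJ + (N₁ * C₂ * (1 / (1 - 4 * b * C₂ * (r + r))) ^ 2 + N * θE')
        + N * θE * (N₁ * C₂ * (1 / (1 - 4 * b * C₂ * (r + r))) ^ 2) * R'
        + N * (1 + θE * R') * CV * (1 / (1 - 4 * b * C₂ * (r + r))) ^ 2)) R' := by
  obtain ⟨hk0, hHk, hΘH, hH1, hHw⟩ := klH_of_entryBounds F N K k Ω U₀ levB (H1prOfRecordAtBg F N K k Ω U₀ (hierFrameDatumOfRecord F N k U₀) levB a hpos hQ) hΩ hkm hB₀ hρ h0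
  obtain ⟨hk'0, hNk, hΘ'0, hΘ', hN₁0, hN₁⟩ := klNPr_of_localityRows_of_entryBounds F N K k Ω U₀ levB (hierFrameDatumOfRecord F N k U₀) a hpos hQ Gp hΩ hkm hs0 hs1 hS hCπ hσ hR hB₀ hρ h0 h1
  exact prop4UniformPrAtRecord_node00_of_prop5Clause_hierFrameRec F N K k Ω U₀ levB a hpos hQ Gp hkpos hkm (mul_nonneg hB₀ (by positivity)) hΩ hαpos hα hreg 
    (prop4LetterHPrAtRecord_of_entryBounds F N K k Ω U₀ (hierFrameDatumOfRecord F N k U₀) levB a hpos hQ hΩ hB₀ hρ h0 h1) hk0 hHk hΘH hH1 hΘH hHw hC₃ h157 hrα₁ hq hk'0 hNk hΘ'0 hΘ' hN₁0 hN₁ hJ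

end Prop4

/-! ## §2  The GL pin `hierFrameGLDatumOfRecord` (no frame debt): (KL-N)ᵖʳ ⇐ {W2} ∧ {W3}; then ALL THREE letter groups ⇐ ONE (3.133) pair ∧ {W3} -/

section Prop4GL

variable (K k : ℕ) (Ω : ℕ → Set (Site (F.P K) 0)) (U₀ : GaugeField (F.P K) 0 (SU N))
variable [Fact (0 < (F.L : ℝ))] [Fact (0 < (F.P K).eta k)] [Fact (0 < c0Rec F K k)] [Fact (∀ c, 0 < wBRec F K k c)]

/-- ★★ **THE GL PIN ✓`prop4UniformPrAtRecord_node00_of_prop5Clause_hierFrameGLRec` WITH THE (KL-N)ᵖʳ GROUP DISCHARGED FROM {W2} ∧ {W3}** (`𝔥 := hierFrameGLDatumOfRecord`,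
`C₂ = 2.816·10¹⁷·L·N`, no frame debt) — ▶ PT-A g12's kernel witness, filed: ✓`klNPr_of_localityRows_of_entryBounds` feeds `hk′0 ∕ hNk ∕ hΘ′0 ∕ hΘ′ ∕ hN₁0 ∕ hN₁` BY NAME
(`N₁ := C_π B₀ d(2(1+1∕m))^d · d(2(1+1∕m))^d`, `Θ′ := (L^d)^k · N₁`); every other displayed letter verbatim.  Glue; nothing of [B7]∕[B9]∕[B11] proved.
[cite: Balaban1985Variational, Prop. 4 (97)–(98) pp.292–293, (72)–(73) p.289, (86)–(89) p.291, (130) p.298; Balaban1985Averaging, Proposition 5 (157) p.42; Balaban1985BackgroundPropagators, Thm 3.12 (3.132)–(3.133) p.422; Balaban1984PropagatorsII, (2.61) p.234] -/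
theorem prop4UniformPrAtRecord_node00_of_prop5Clause_hierFrameGLRec_of_localityRows (levB : PBond (F.P K) k → ℕ) (a : ℝ)
    (hpos : ∀ x, x ≠ 0 → 0 < RCLike.re ⟪x, laplaceAOfRecord F N k U₀ (QprOfRecord F N k U₀ (hierFrameGLDatumOfRecord F N k U₀)) (QprimeOfRecord F N k U₀) a x⟫_ℂ)
    (hQ : Function.Surjective (QprOfRecord F N k U₀ (hierFrameGLDatumOfRecord F N k U₀)))
    (Gp : SiteL2K ℂ (F.P K).d (fun _ => (F.P K).sitesPerDir 0) (c0Rec F K k) (WRec N) →ₗ[ℂ]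
      SiteL2K ℂ (F.P K).d (fun _ => (F.P K).sitesPerDir 0) (c0Rec F K k) (WRec N))
    {b α nJ : ℝ} (hkpos : 0 < k) (hkm : k ≤ (F.P K).m + (F.P K).K) (hb : 0 ≤ b) (hΩ : ∀ x, x ∈ Ω k) (hαpos : 0 < α) (hα : α * (11000000 * N) ≤ 1)
    (hreg : ∀ j, j < k → PlaqSmall (α * ((F.L : ℝ) ^ j * (F.P K).eta k) ^ 2) (Averaging.iter (avOfRecord F N K) j U₀))
    (hH : Prop4LetterHPrAtRecord F N K k Ω U₀ (hierFrameGLDatumOfRecord F N k U₀) levB a hpos hQ b)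
    -- (KL-H)ᵖʳ
    {hk : Bond (F.P K).d (fun _ => (F.P K).sitesPerDir 0) → PBond (F.P K) k → ℝ} (hk0 : ∀ b' y, 0 ≤ hk b' y)
    (hHk : ∀ (y : PBond (F.P K) k) (Z : Matrix (Fin N) (Fin N) ℂ) (b' : Bond (F.P K).d (fun _ => (F.P K).sitesPerDir 0)),
      ‖flat115 (H1prOfRecordAtBg F N K k Ω U₀ (hierFrameGLDatumOfRecord F N k U₀) levB a hpos hQ
          ((NegSup.equiv (levWeight (F.L : ℝ) ((F.P K).eta k) levB 0) (Matrix (Fin N) (Fin N) ℂ)).symm (Pi.single y Z))) b'‖ ≤ hk b' y * ‖Z‖)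
    {ΘH : ℝ} (hΘH : 0 ≤ ΘH) (hH1 : ∀ y, ∑ b', hk b' y ≤ ΘH) {ΘHw : ℝ} (hΘHw : 0 ≤ ΘHw)
    (hHw : ∀ (bb : Bond (F.P K).d (fun _ => (F.P K).sitesPerDir 0)) (y : PBond (F.P K) k),
      ∑ b', levWeight (F.L : ℝ) ((F.P K).eta k) (bondLevLit F Ω k) 3 bb / levWeight (F.L : ℝ) ((F.P K).eta k) (bondLevLit F Ω k) 3 b' * hk b' y ≤ ΘHw)
    -- (KL-C)ᵖʳ := the (157) clause of `B7.Prop5Printed (kexpOfRecordPr F N 𝔥ᴳᴸ)` at `(α, α₁, C₃)`, `r + r ≤ α₁`, and the window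
    {C₃ α₁ : ℝ} (hC₃ : 0 ≤ C₃)
    (h157 : ∀ (i : KRecIdx F) (U₀ : (kexpOfRecordPr F N (fun K k (U₀ : GaugeField (F.P K) 0 (SU N)) => hierFrameGLDatumOfRecord F N k U₀) i).Cfg), (kexpOfRecordPr F N (fun K k (U₀ : GaugeField (F.P K) 0 (SU N)) => hierFrameGLDatumOfRecord F N k U₀) i).plaqDevEta U₀ < α →
      ∀ A : (kexpOfRecordPr F N (fun K k (U₀ : GaugeField (F.P K) 0 (SU N)) => hierFrameGLDatumOfRecord F N k U₀) i).Fld, (kexpOfRecordPr F N (fun K k (U₀ : GaugeField (F.P K) 0 (SU N)) => hierFrameGLDatumOfRecord F N k U₀) i).fldNorm A < α₁ → (kexpOfRecordPr F N (fun K k (U₀ : GaugeField (F.P K) 0 (SU N)) => hierFrameGLDatumOfRecord F N k U₀) i).dCk U₀ A ≤ C₃ * (kexpOfRecordPr F N (fun K k (U₀ : GaugeField (F.P K) 0 (SU N)) => hierFrameGLDatumOfRecord F N k U₀) i).fldNorm A)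
    (hrα₁ : letI C₂ : ℝ := 281600000000000000 * (F.L : ℝ) * N
      letI c₄ : ℝ := 1 / (200000000000 * (F.L : ℝ) * N)
      letI r : ℝ := min (c₄ / 4) (min (1 / 2) (1 / (16 * (b * C₂ + 1))))
      r + r ≤ α₁)
    (hq : letI C₂ : ℝ := 281600000000000000 * (F.L : ℝ) * N
      letI c₄ : ℝ := 1 / (200000000000 * (F.L : ℝ) * N)
      letI r : ℝ := min (c₄ / 4) (min (1 / 2) (1 / (16 * (b * C₂ + 1))))
      (r + r) * ΘH * (2 * ((F.P K).d : ℝ) * (C₃ * (F.P K).eta k ^ (F.P K).d)) ≤ 1 / 2)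
    -- {W3} := the locality rows of the current reader `Δπ(U₀; G′, Q′)` ([B11] (72)–(73)∕(86)–(89)): (L) fine majorants `s₀, s₁`, (R) block-aggregated row decay — DISPLAYED
    {s0 : Bond (F.P K).d (fun _ => (F.P K).sitesPerDir 0) → Bond (F.P K).d (fun _ => (F.P K).sitesPerDir 0) → ℝ} {s1 : Bond (F.P K).d (fun _ => (F.P K).sitesPerDir 0) → Bond (F.P K).d (fun _ => (F.P K).sitesPerDir 0) × Fin (F.P K).d → ℝ} (hs0 : ∀ b' x, 0 ≤ s0 b' x) (hs1 : ∀ b' p, 0 ≤ s1 b' p)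
    (hS : ∀ (A : Space115Lit F N K k Ω U₀) (b' : Bond (F.P K).d (fun _ => (F.P K).sitesPerDir 0)),
      ‖NegSup.equiv (levWeight (F.L : ℝ) ((F.P K).eta k) (bondLevLit F Ω k) 3) (Matrix (Fin N) (Fin N) ℂ) (DeltaPiCurOfRecord F N K k Ω U₀ Gp (QprimeOfRecord F N k U₀) A) b'‖ ≤
        ∑ x : Bond (F.P K).d (fun _ => (F.P K).sitesPerDir 0), s0 b' x * ‖JetSup.equiv _ _ _ A x‖ +
        ∑ p : Bond (F.P K).d (fun _ => (F.P K).sitesPerDir 0) × Fin (F.P K).d, s1 b' p * ‖(nabla115 ((F.P K).eta k) (unitsOfRecord F N U₀)) (JetSup.equiv _ _ _ A) p‖)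
    {Cπ σ : ℝ} (hCπ : 0 ≤ Cπ) (hσ : 0 < σ)
    (hR : ∀ (b' : Bond (F.P K).d (fun _ => (F.P K).sitesPerDir 0)) (y'' : PBond (F.P K) k),
      blockRow0 F K k s0 b' y'' + blockRow1 F K k s1 b' y'' ≤
        Cπ * Real.exp (-(σ * (Site.tdist (blkOfBond F K k b').src y''.src : ℝ))))
    -- {W2} := the (3.133) entry rows of `H₁^{pr}(U₀)` at `(B₀, ρ)` ([B9] Thm 3.12; lane N07) — DISPLAYED
    {B₀ ρ : ℝ} (hB₀ : 0 ≤ B₀) (hρ : 0 < ρ)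
    (h0 : ∀ y'' y : PBond (F.P K) k, entry0 F N K k Ω U₀ levB (H1prOfRecordAtBg F N K k Ω U₀ (hierFrameGLDatumOfRecord F N k U₀) levB a hpos hQ) y'' y ≤ B₀ * Real.exp (-(ρ * (Site.tdist y''.src y.src : ℝ))))
    (h1 : ∀ y'' y : PBond (F.P K) k, entry1 F N K k Ω U₀ levB (H1prOfRecordAtBg F N K k Ω U₀ (hierFrameGLDatumOfRecord F N k U₀) levB a hpos hQ) y'' y ≤ B₀ * Real.exp (-(ρ * (Site.tdist y''.src y.src : ℝ))))
    (hJ : ‖JOfRecordAtBg F N K k Ω U₀‖ ≤ nJ) :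
    letI N₁ : ℝ := Cπ * B₀ * ((F.P K).d * (2 * (1 + 1 / (min σ ρ / 2))) ^ (F.P K).d) * ((F.P K).d * (2 * (1 + 1 / (min σ ρ / 2))) ^ (F.P K).d)
    letI Θ' : ℝ := ((((F.P K).L ^ (F.P K).d) ^ k : ℕ) : ℝ) * N₁
    letI C₂ : ℝ := 281600000000000000 * (F.L : ℝ) * N
    letI c₄ : ℝ := 1 / (200000000000 * (F.L : ℝ) * N)
    letI r : ℝ := min (c₄ / 4) (min (1 / 2) (1 / (16 * (b * C₂ + 1))))
    letI R' : ℝ := min r ((1 - 4 * b * C₂ * (r + r)) * (1 / 16))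
    letI CV : ℝ := 1024 * (((F.P K).d - 1 : ℕ) : ℝ) * ((1 : ℝ) * 1) ^ 3 * N * (α * (1 : ℝ) ^ 2 + 1 / 16)
        + (((F.P K).d - 1 : ℕ) : ℝ) * ((1 : ℝ) * 1) ^ 3 * (136 + 2 * ((1 : ℝ) * 1)) * N
    letI G : ℝ := 2 * ((F.P K).d : ℝ) * (C₃ * (F.P K).eta k ^ (F.P K).d)
    letI θ₃ : ℝ := (2 * (1 / (1 - 4 * b * C₂ * (r + r))) + 1) * ΘHw * G / r
    letI θE : ℝ := 2 * ΘHw * G * (1 / (1 - 4 * b * C₂ * (r + r)))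
    letI θE' : ℝ := 2 * Θ' * G * (1 / (1 - 4 * b * C₂ * (r + r)))
    Prop4UniformPrAtRecord F N K k Ω U₀ (hierFrameGLDatumOfRecord F N k U₀) levB a hpos hQ r Gp
      ((N * θ₃ * nJ + (N₁ * C₂ * (1 / (1 - 4 * b * C₂ * (r + r))) ^ 2 + N * θE')
        + N * θE * (N₁ * C₂ * (1 / (1 - 4 * b * C₂ * (r + r))) ^ 2) * R'
        + N * (1 + θE * R') * CV * (1 / (1 - 4 * b * C₂ * (r + r))) ^ 2)) R' := by
  obtain ⟨hk'0, hNk, hΘ'0, hΘ', hN₁0, hN₁⟩ := klNPr_of_localityRows_of_entryBounds F N K k Ω U₀ levB (hierFrameGLDatumOfRecord F N k U₀) a hpos hQ Gp hΩ hkm hs0 hs1 hS hCπ hσ hR hB₀ hρ h0 h1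
  exact prop4UniformPrAtRecord_node00_of_prop5Clause_hierFrameGLRec F N K k Ω U₀ levB a hpos hQ Gp hkpos hkm hb hΩ hαpos hα hreg hH hk0 hHk hΘH hH1 hΘHw hHw hC₃ h157 hrα₁ hq
    hk'0 hNk hΘ'0 hΘ' hN₁0 hN₁ hJ

/-- ★★★ **THE GL PIN WITH ALL THREE PROPAGATOR LETTER GROUPS DISCHARGED FROM ONE DISPLAYED (3.133) PAIR AND THE LOCALITY ROWS OF `Δπ`** (`𝔥 := hierFrameGLDatumOfRecord`, no
frame debt, `C₂ = 2.816·10¹⁷·L·N`): (ℓa-H)ᵖʳ by ✓`prop4LetterHPrAtRecord_of_entryBounds` (`b := B₀ · d(2(1+1∕ρ))^d`), (KL-H)ᵖʳ by ✓`klH_of_entryBounds` (`Θ_H = Θ_H^w := (L^d)^k · b`), (KL-N)ᵖʳ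
by ▶ PT-A's ✓`klNPr_of_localityRows_of_entryBounds`.  REMAINING displayed letters: `hpos`∕`hQ` at `QprOfRecord … (hierFrameGLDatumOfRecord …)` (`hQ` ⟸ ✓`QprOfRecord_surjective_hierFrameGL_of_qCplxOp`),
{W2} `h0 ∕ h1`, {W3} `hS ∕ hR`, the (157) clause `h157` of `B7.Prop5Printed (kexpOfRecordPr F N 𝔥ᴳᴸ)` with `r + r ≤ α₁` and the window `hq`, `‖J‖ ≤ nJ`, print's (14) `hreg`, `∀ x, x ∈ Ω_k`.
Glue BY NAME; {W2}∕{W3} INHABITED NOWHERE; nothing of [B7]∕[B9]∕[B11] proved.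
[cite: Balaban1985Variational, Prop. 4 (97)–(98) pp.292–293, (45)–(46) p.285, (72)–(73) p.289, (86)–(89) p.291, (103) p.293, (130) p.298; Balaban1985Averaging, Proposition 5 (157) p.42; Balaban1985BackgroundPropagators, Thm 3.12 (3.126) p.420, (3.132)–(3.133) p.422; Balaban1984PropagatorsII, Lemma 2.1 (2.61) p.234] -/
theorem prop4UniformPrAtRecord_node00_of_prop5Clause_hierFrameGLRec_of_entryRows (levB : PBond (F.P K) k → ℕ) (a : ℝ)
    (hpos : ∀ x, x ≠ 0 → 0 < RCLike.re ⟪x, laplaceAOfRecord F N k U₀ (QprOfRecord F N k U₀ (hierFrameGLDatumOfRecord F N k U₀)) (QprimeOfRecord F N k U₀) a x⟫_ℂ)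
    (hQ : Function.Surjective (QprOfRecord F N k U₀ (hierFrameGLDatumOfRecord F N k U₀)))
    (Gp : SiteL2K ℂ (F.P K).d (fun _ => (F.P K).sitesPerDir 0) (c0Rec F K k) (WRec N) →ₗ[ℂ]
      SiteL2K ℂ (F.P K).d (fun _ => (F.P K).sitesPerDir 0) (c0Rec F K k) (WRec N))
    {α nJ : ℝ} (hkpos : 0 < k) (hkm : k ≤ (F.P K).m + (F.P K).K) (hΩ : ∀ x, x ∈ Ω k) (hαpos : 0 < α) (hα : α * (11000000 * N) ≤ 1)
    (hreg : ∀ j, j < k → PlaqSmall (α * ((F.L : ℝ) ^ j * (F.P K).eta k) ^ 2) (Averaging.iter (avOfRecord F N K) j U₀))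
    -- {W2} := the (3.133) entry rows of `H₁^{pr}(U₀)` at `(B₀, ρ)` ([B9] Thm 3.12; lane N07) — DISPLAYED
    {B₀ ρ : ℝ} (hB₀ : 0 ≤ B₀) (hρ : 0 < ρ)
    (h0 : ∀ y'' y : PBond (F.P K) k, entry0 F N K k Ω U₀ levB (H1prOfRecordAtBg F N K k Ω U₀ (hierFrameGLDatumOfRecord F N k U₀) levB a hpos hQ) y'' y ≤ B₀ * Real.exp (-(ρ * (Site.tdist y''.src y.src : ℝ))))
    (h1 : ∀ y'' y : PBond (F.P K) k, entry1 F N K k Ω U₀ levB (H1prOfRecordAtBg F N K k Ω U₀ (hierFrameGLDatumOfRecord F N k U₀) levB a hpos hQ) y'' y ≤ B₀ * Real.exp (-(ρ * (Site.tdist y''.src y.src : ℝ))))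
    -- (KL-C)ᵖʳ := the (157) clause of `B7.Prop5Printed (kexpOfRecordPr F N 𝔥ᴳᴸ)` at `(α, α₁, C₃)`, `r + r ≤ α₁`, and the window
    {C₃ α₁ : ℝ} (hC₃ : 0 ≤ C₃)
    (h157 : ∀ (i : KRecIdx F) (U₀ : (kexpOfRecordPr F N (fun K k (U₀ : GaugeField (F.P K) 0 (SU N)) => hierFrameGLDatumOfRecord F N k U₀) i).Cfg), (kexpOfRecordPr F N (fun K k (U₀ : GaugeField (F.P K) 0 (SU N)) => hierFrameGLDatumOfRecord F N k U₀) i).plaqDevEta U₀ < α →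
      ∀ A : (kexpOfRecordPr F N (fun K k (U₀ : GaugeField (F.P K) 0 (SU N)) => hierFrameGLDatumOfRecord F N k U₀) i).Fld, (kexpOfRecordPr F N (fun K k (U₀ : GaugeField (F.P K) 0 (SU N)) => hierFrameGLDatumOfRecord F N k U₀) i).fldNorm A < α₁ → (kexpOfRecordPr F N (fun K k (U₀ : GaugeField (F.P K) 0 (SU N)) => hierFrameGLDatumOfRecord F N k U₀) i).dCk U₀ A ≤ C₃ * (kexpOfRecordPr F N (fun K k (U₀ : GaugeField (F.P K) 0 (SU N)) => hierFrameGLDatumOfRecord F N k U₀) i).fldNorm A)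
    (hrα₁ : letI b : ℝ := B₀ * ((F.P K).d * (2 * (1 + 1 / ρ)) ^ (F.P K).d)
      letI C₂ : ℝ := 281600000000000000 * (F.L : ℝ) * N
      letI c₄ : ℝ := 1 / (200000000000 * (F.L : ℝ) * N)
      letI r : ℝ := min (c₄ / 4) (min (1 / 2) (1 / (16 * (b * C₂ + 1))))
      r + r ≤ α₁)
    (hq : letI b : ℝ := B₀ * ((F.P K).d * (2 * (1 + 1 / ρ)) ^ (F.P K).d)
      letI ΘH : ℝ := ((((F.P K).L ^ (F.P K).d) ^ k : ℕ) : ℝ) * b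
      letI C₂ : ℝ := 281600000000000000 * (F.L : ℝ) * N
      letI c₄ : ℝ := 1 / (200000000000 * (F.L : ℝ) * N)
      letI r : ℝ := min (c₄ / 4) (min (1 / 2) (1 / (16 * (b * C₂ + 1))))
      (r + r) * ΘH * (2 * ((F.P K).d : ℝ) * (C₃ * (F.P K).eta k ^ (F.P K).d)) ≤ 1 / 2)
    -- {W3} := the locality rows of the current reader `Δπ(U₀; G′, Q′)` ([B11] (72)–(73)∕(86)–(89)): (L) fine majorants `s₀, s₁`, (R) block-aggregated row decay — DISPLAYED
    {s0 : Bond (F.P K).d (fun _ => (F.P K).sitesPerDir 0) → Bond (F.P K).d (fun _ => (F.P K).sitesPerDir 0) → ℝ} {s1 : Bond (F.P K).d (fun _ => (F.P K).sitesPerDir 0) → Bond (F.P K).d (fun _ => (F.P K).sitesPerDir 0) × Fin (F.P K).d → ℝ} (hs0 : ∀ b' x, 0 ≤ s0 b' x) (hs1 : ∀ b' p, 0 ≤ s1 b' p)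
    (hS : ∀ (A : Space115Lit F N K k Ω U₀) (b' : Bond (F.P K).d (fun _ => (F.P K).sitesPerDir 0)),
      ‖NegSup.equiv (levWeight (F.L : ℝ) ((F.P K).eta k) (bondLevLit F Ω k) 3) (Matrix (Fin N) (Fin N) ℂ) (DeltaPiCurOfRecord F N K k Ω U₀ Gp (QprimeOfRecord F N k U₀) A) b'‖ ≤
        ∑ x : Bond (F.P K).d (fun _ => (F.P K).sitesPerDir 0), s0 b' x * ‖JetSup.equiv _ _ _ A x‖ +
        ∑ p : Bond (F.P K).d (fun _ => (F.P K).sitesPerDir 0) × Fin (F.P K).d, s1 b' p * ‖(nabla115 ((F.P K).eta k) (unitsOfRecord F N U₀)) (JetSup.equiv _ _ _ A) p‖)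
    {Cπ σ : ℝ} (hCπ : 0 ≤ Cπ) (hσ : 0 < σ)
    (hR : ∀ (b' : Bond (F.P K).d (fun _ => (F.P K).sitesPerDir 0)) (y'' : PBond (F.P K) k),
      blockRow0 F K k s0 b' y'' + blockRow1 F K k s1 b' y'' ≤
        Cπ * Real.exp (-(σ * (Site.tdist (blkOfBond F K k b').src y''.src : ℝ))))
    (hJ : ‖JOfRecordAtBg F N K k Ω U₀‖ ≤ nJ) :
    letI b : ℝ := B₀ * ((F.P K).d * (2 * (1 + 1 / ρ)) ^ (F.P K).d)
    letI ΘHw : ℝ := ((((F.P K).L ^ (F.P K).d) ^ k : ℕ) : ℝ) * b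
    letI N₁ : ℝ := Cπ * B₀ * ((F.P K).d * (2 * (1 + 1 / (min σ ρ / 2))) ^ (F.P K).d) * ((F.P K).d * (2 * (1 + 1 / (min σ ρ / 2))) ^ (F.P K).d)
    letI Θ' : ℝ := ((((F.P K).L ^ (F.P K).d) ^ k : ℕ) : ℝ) * N₁
    letI C₂ : ℝ := 281600000000000000 * (F.L : ℝ) * N
    letI c₄ : ℝ := 1 / (200000000000 * (F.L : ℝ) * N)
    letI r : ℝ := min (c₄ / 4) (min (1 / 2) (1 / (16 * (b * C₂ + 1))))
    letI R' : ℝ := min r ((1 - 4 * b * C₂ * (r + r)) * (1 / 16))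
    letI CV : ℝ := 1024 * (((F.P K).d - 1 : ℕ) : ℝ) * ((1 : ℝ) * 1) ^ 3 * N * (α * (1 : ℝ) ^ 2 + 1 / 16)
        + (((F.P K).d - 1 : ℕ) : ℝ) * ((1 : ℝ) * 1) ^ 3 * (136 + 2 * ((1 : ℝ) * 1)) * N
    letI G : ℝ := 2 * ((F.P K).d : ℝ) * (C₃ * (F.P K).eta k ^ (F.P K).d)
    letI θ₃ : ℝ := (2 * (1 / (1 - 4 * b * C₂ * (r + r))) + 1) * ΘHw * G / r
    letI θE : ℝ := 2 * ΘHw * G * (1 / (1 - 4 * b * C₂ * (r + r)))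
    letI θE' : ℝ := 2 * Θ' * G * (1 / (1 - 4 * b * C₂ * (r + r)))
    Prop4UniformPrAtRecord F N K k Ω U₀ (hierFrameGLDatumOfRecord F N k U₀) levB a hpos hQ r Gp
      ((N * θ₃ * nJ + (N₁ * C₂ * (1 / (1 - 4 * b * C₂ * (r + r))) ^ 2 + N * θE')
        + N * θE * (N₁ * C₂ * (1 / (1 - 4 * b * C₂ * (r + r))) ^ 2) * R'
        + N * (1 + θE * R') * CV * (1 / (1 - 4 * b * C₂ * (r + r))) ^ 2)) R' := by
  obtain ⟨hk0, hHk, hΘH, hH1, hHw⟩ := klH_of_entryBounds F N K k Ω U₀ levB (H1prOfRecordAtBg F N K k Ω U₀ (hierFrameGLDatumOfRecord F N k U₀) levB a hpos hQ) hΩ hkm hB₀ hρ h0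
  obtain ⟨hk'0, hNk, hΘ'0, hΘ', hN₁0, hN₁⟩ := klNPr_of_localityRows_of_entryBounds F N K k Ω U₀ levB (hierFrameGLDatumOfRecord F N k U₀) a hpos hQ Gp hΩ hkm hs0 hs1 hS hCπ hσ hR hB₀ hρ h0 h1
  exact prop4UniformPrAtRecord_node00_of_prop5Clause_hierFrameGLRec F N K k Ω U₀ levB a hpos hQ Gp hkpos hkm (mul_nonneg hB₀ (by positivity)) hΩ hαpos hα hreg 
    (prop4LetterHPrAtRecord_of_entryBounds F N K k Ω U₀ (hierFrameGLDatumOfRecord F N k U₀) levB a hpos hQ hΩ hB₀ hρ h0 h1) hk0 hHk hΘH hH1 hΘH hHw hC₃ h157 hrα₁ hq hk'0 hNk hΘ'0 hΘ' hN₁0 hN₁ hJ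

end Prop4GL

end Summit.QuantumFields.YangMills.Theorems.KExpOfRecordPr

end
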